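import Literature.Computability.AlgebraicComplexity.MoreAsymConstituentStructure
import Literature.Computability.AlgebraicComplexity.MoreAsymHashedZeroOutHoles
import Literature.Computability.AlgebraicComplexity.ConstituentStageCompatCount
import HarnessLib

/-!
# `p_compY` one level down: Def. 6.16 is well posed and Claim 6.18 as an exact double count
(Alman–Duan–Vassilevska Williams–Xu–Xu–Zhou 2025, §6.5: Def. 6.16, Claim 6.18, Claim 6.21) — proved

Topic `Literature/Computability/AlgebraicComplexity`.  §6.5 of Alman–Duan–Vassilevska Williams–Xu–Xu–
Zhou, *More asymmetry yields faster matrix multiplication* (SODA 2025, arXiv:2404.16349):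

> **Definition 6.16 (`p_compY`).** For fixed `Y_Ĵ` and `Y_J` where `Y_Ĵ ∈ Y_J` and `Ĵ` has level-`ℓ`
> complete split distributions `{ξ_{Y,t}}`, we define `p*_compY({ξ_{Y,t}})` as the probability that a
> uniformly random level-`(ℓ−1)` block triple `X_I Y_J Z_K` consistent with `{α_t}` is compatible with
> `Y_Ĵ` … `p_compY` does not depend on the choice of `Y_Ĵ` and `Y_J` by symmetry, so it is well-defined.
> **Claim 6.18** [proof: the ratio of two quantities, with the level-`ℓ` condition dropped — an
> over-estimation].  **Claim 6.21**: the probability that a typical `Y_Ĵ` is compatible with multiple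
> triples is at most `numalpha · p_compY / (numyblock · M₀)`.

This file PROVES the "by symmetry" steps and the resulting exact inequality for the data
`D : ConstituentRegion c n s M` of one region — the `Y`-twin of `ConstituentStageCompatCount.lean` (VXXZ
Def. 6.12 / Claim 6.13 for `Z`), whose symmetry tools (chunk symmetries acting on both halves, transitivity
on the `{α_t}`-consistent triples, `shapeClass`) are reused:

* `pairClassY_actSeq`, `isTypicalY₂_actSeq_iff`, `isYCompatibleWith₂_actSeq_iff` — equivariance of the
  classes `S_{t,*,j',*}`, of `Y`-typicalness and of `Y`-compatibility (Def. 6.8);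
* `compatCountY₂_eq` — the number `C_Y` of level-1 `Y`-blocks `Y`-compatible with a consistent triple does not
  depend on it; `card_compatTriplesY₂_eq_of_mem_shapeClass` — **Def. 6.16 is well posed**: the number
  `V_Y(Ĵ)` of consistent triples through `Y_J` `Y`-compatible with `Ĵ` only depends on `{ξ_{Y,t}}`;
* `card_compatTriplesY₂_mul_card_shapeClass_le` — **Claim 6.18 as a double count**:
  `V_Y(Ĵ) · #{Ĵ' : ξ(Ĵ') = ξ(Ĵ)} ≤ numalpha · C_Y`;
* `card_holePairsYIn_le`, `card_holePairsYIn_mul_le` — consequently the `Y`-hole count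
  `U_Y(T) = |holePairsYIn A T|` of `MoreAsymHashedZeroOutHoles.lean` satisfies
  `U_Y(T) · m ≤ M_Y(T) · numalpha · C_Y` whenever every relevant useful `Ĵ` has `#{Ĵ' : ξ(Ĵ') = ξ(Ĵ)} ≥ m`
  (Claim 6.21's proof).

Everything is proved; the definitions are the counted sets; no named facts.  The product / entropy formulas
for `C_Y`, `#{Ĵ' : ξ}`, `numalpha` (`η_{Y,t}`, `H(ξ_{Y,t})`, `H(α_t)`) are not part of this file.

## References

* J. Alman, R. Duan, V. Vassilevska Williams, Y. Xu, Z. Xu, R. Zhou, *More asymmetry yields faster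
  matrix multiplication*, SODA 2025, arXiv:2404.16349 (held: `paper:arxiv-2404.16349`, chunks
  p0025–p0026): Def. 6.16, Claim 6.18 and its proof, Claim 6.21. [AlmanDuanVassilevskaWilliamsXuXuZhou2025]
* V. Vassilevska Williams, Y. Xu, Z. Xu, R. Zhou, *New bounds for matrix multiplication: from alpha
  to omega*, SODA 2024, arXiv:2307.07970, §6.6 (Def. 6.12, Claims 6.13, 6.15 — the `Z` originals).
  [VassilevskaWilliamsXuXuZhou2024]
-/

noncomputable section

open scoped BigOperators
open Finset

namespace Literature.Computability.AlgebraicComplexity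

/-! ## Equivariance of the `Y`-notions under the chunk symmetries acting on both halves -/

section Equivariance

variable {c n s : ℕ} (τ : Fin n → Fin s)

/-- The classes `S_{t,*,j',*}` of a permuted block. [cite: AlmanDuanVassilevskaWilliamsXuXuZhou2025, §6.3 and Def. 6.16 ("by symmetry")] -/
theorem pairClassY_actSeq {σ : Equiv.Perm (Fin n)} (hσ : σ ∈ chunkSymmetries τ) (J : Fin (n + n) → ℕ) (t : Fin s) (j : ℕ) :
    pairClassY τ (actSeq σ J) t j = (pairClassY τ J t j).map (doublePerm σ).toEmbedding := by
  ext p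
  rw [mem_map_equiv, mem_pairClassY, mem_pairClassY, halfTermOf_doublePerm_symm τ hσ]
  rfl

/-- **`Y`-typicalness is invariant under the chunk symmetries.** [cite: AlmanDuanVassilevskaWilliamsXuXuZhou2025, Def. 6.8 (second item)] -/
theorem isTypicalY₂_actSeq_iff {σ : Equiv.Perm (Fin n)} (hσ : σ ∈ chunkSymmetries τ) (L : Fin s → InterfaceTerm (c + c))
    (w : Fin s → ℕ × ℕ × ℕ → ℝ) (βY : Fin s → ℕ × ℕ × ℕ → (Fin c → Fin 3) → ℝ) (J : Fin (n + n) → ℕ) (Jh : Fin (n + n) → Fin c → Fin 3) :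
    IsTypicalY₂ τ L w βY (actSeq σ J) (actSeq σ Jh) ↔ IsTypicalY₂ τ L w βY J Jh := by
  simp only [IsTypicalY₂, pairClassY_actSeq τ hσ, completeSplitOn_actSeq_map, map_nonempty]

/-- **`Y`-compatibility (Def. 6.8) is invariant under the chunk symmetries.** [cite: AlmanDuanVassilevskaWilliamsXuXuZhou2025, Def. 6.8 and Def. 6.16 ("by symmetry")] -/
theorem isYCompatibleWith₂_actSeq_iff {σ : Equiv.Perm (Fin n)} (hσ : σ ∈ chunkSymmetries τ) (L : Fin s → InterfaceTerm (c + c))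
    (w : Fin s → ℕ × ℕ × ℕ → ℝ) (βY : Fin s → ℕ × ℕ × ℕ → (Fin c → Fin 3) → ℝ) (I J K : Fin (n + n) → ℕ)
    (Jh : Fin (n + n) → Fin c → Fin 3) :
    IsYCompatibleWith₂ τ L w βY (actSeq σ I) (actSeq σ J) (actSeq σ K) (actSeq σ Jh) ↔ IsYCompatibleWith₂ τ L w βY I J K Jh := by
  simp only [IsYCompatibleWith₂, pairClass_actSeq τ hσ, completeSplitOn_actSeq_map, map_nonempty,
    isTypicalY₂_actSeq_iff τ hσ]

end Equivariance

/-! ## `C_Y` and `V_Y` are well defined; Claim 6.18 as a double count -/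

namespace ConstituentRegion

open scoped Classical

variable {c n s M : ℕ} {D : ConstituentRegion c n s M}

/-- The `Y`-usefulness of the stage is Def. 6.10. [folklore] -/
theorem toMoreAsymHashed_UY (T : (Fin (n + n) → Fin (2 * c + 1)) × (Fin (n + n) → Fin (2 * c + 1)) × (Fin (n + n) → Fin (2 * c + 1)))
    (Jh : Fin (n + n) → Fin c → Fin 3) :
    D.toMoreAsymHashed.UY T Jh = IsUsefulFor₂ D.τ D.βY (seqVal T.1) (seqVal T.2.1) (seqVal T.2.2) Jh := rfl

variable (D) in
/-- **`C_Y(T)`**: the number of level-1 `Y`-blocks `Y_Ĵ ∈ Y_J` `Y`-compatible (Def. 6.8) with the triple `T`.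
[cite: AlmanDuanVassilevskaWilliamsXuXuZhou2025, Claim 6.18 (proof, per triple)] -/
def compatCountY₂ (T : (Fin (n + n) → Fin (2 * c + 1)) × (Fin (n + n) → Fin (2 * c + 1)) × (Fin (n + n) → Fin (2 * c + 1))) : ℕ :=
  (univ.filter fun Jh : Fin (n + n) → Fin c → Fin 3 => blockOfSeq Jh = T.2.1 ∧ D.toMoreAsymHashed.CY T Jh).card

/-- `Y`-compatibility with a permuted triple. [cite: AlmanDuanVassilevskaWilliamsXuXuZhou2025, Def. 6.8] -/
theorem cy_permTriple_actSeq_iff {σ : Equiv.Perm (Fin n)} (hσ : σ ∈ chunkSymmetries D.τ)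
    (T : (Fin (n + n) → Fin (2 * c + 1)) × (Fin (n + n) → Fin (2 * c + 1)) × (Fin (n + n) → Fin (2 * c + 1)))
    (Jh : Fin (n + n) → Fin c → Fin 3) : D.toMoreAsymHashed.CY (permTriple σ T) (actSeq σ Jh) ↔ D.toMoreAsymHashed.CY T Jh := by
  rw [toMoreAsymHashed_CY, toMoreAsymHashed_CY]
  show IsYCompatibleWith₂ D.τ D.L _ D.βY (seqVal (actSeq σ T.1)) (seqVal (actSeq σ T.2.1)) (seqVal (actSeq σ T.2.2)) (actSeq σ Jh) ↔ _
  rw [seqVal_actSeq, seqVal_actSeq, seqVal_actSeq, isYCompatibleWith₂_actSeq_iff D.τ hσ]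

/-- `Y`-usefulness for a permuted triple. [cite: AlmanDuanVassilevskaWilliamsXuXuZhou2025, Def. 6.10] -/
theorem uy_permTriple_actSeq_iff {σ : Equiv.Perm (Fin n)} (hσ : σ ∈ chunkSymmetries D.τ)
    (T : (Fin (n + n) → Fin (2 * c + 1)) × (Fin (n + n) → Fin (2 * c + 1)) × (Fin (n + n) → Fin (2 * c + 1)))
    (Jh : Fin (n + n) → Fin c → Fin 3) : D.toMoreAsymHashed.UY (permTriple σ T) (actSeq σ Jh) ↔ D.toMoreAsymHashed.UY T Jh := by
  rw [toMoreAsymHashed_UY, toMoreAsymHashed_UY]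
  show IsUsefulFor₂ D.τ D.βY (seqVal (actSeq σ T.1)) (seqVal (actSeq σ T.2.1)) (seqVal (actSeq σ T.2.2)) (actSeq σ Jh) ↔ _
  rw [seqVal_actSeq, seqVal_actSeq, seqVal_actSeq, isUsefulFor₂_actSeq_iff D.τ hσ]

/-- **`C_Y` does not depend on the consistent triple** ("by symmetry"). [cite: AlmanDuanVassilevskaWilliamsXuXuZhou2025, Claim 6.18 (proof) and Def. 6.16] -/
theorem compatCountY₂_eq (hD : D.WellFormed)
    {T T' : (Fin (n + n) → Fin (2 * c + 1)) × (Fin (n + n) → Fin (2 * c + 1)) × (Fin (n + n) → Fin (2 * c + 1))}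
    (hT : T ∈ D.consistent) (hT' : T' ∈ D.consistent) : D.compatCountY₂ T = D.compatCountY₂ T' := by
  obtain ⟨σ, hσ, he⟩ := exists_chunkSymm_permTriple_eq hD hT hT'
  refine card_nbij' (actSeq σ) (actSeq σ.symm) (fun Jh hJh => ?_) (fun Jh hJh => ?_)
    (fun Jh _ => actSeq_symm_actSeq σ Jh) (fun Jh _ => actSeq_actSeq_symm σ Jh)
  · have h := mem_filter.1 (mem_coe.1 hJh)
    refine mem_coe.2 (mem_filter.2 ⟨mem_univ _, ?_, ?_⟩)
    · rw [blockOfSeq_actSeq, h.2.1, ← he]; rfl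
    · rw [← he, cy_permTriple_actSeq_iff hσ]; exact h.2.2
  · have h := mem_filter.1 (mem_coe.1 hJh)
    have hσ' : σ.symm ∈ chunkSymmetries D.τ := (chunkSymmetries D.τ).inv_mem hσ
    have he' : permTriple σ.symm T' = T := by rw [← he, permTriple_symm_permTriple]
    refine mem_coe.2 (mem_filter.2 ⟨mem_univ _, ?_, ?_⟩)
    · rw [blockOfSeq_actSeq, h.2.1, ← he']; rfl
    · rw [← he', cy_permTriple_actSeq_iff hσ']; exact h.2.2

variable (D) in
/-- **The `{α_t}`-consistent triples through `Y_J` that are `Y`-compatible with `Ĵ ∈ Y_J`** (their number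
`V_Y(Ĵ)` is `p*_compY · numalpha / numyblock`). [cite: AlmanDuanVassilevskaWilliamsXuXuZhou2025, Def. 6.16 and Claim 6.21] -/
def compatTriplesY₂ (Jh : Fin (n + n) → Fin c → Fin 3) :
    Finset ((Fin (n + n) → Fin (2 * c + 1)) × (Fin (n + n) → Fin (2 * c + 1)) × (Fin (n + n) → Fin (2 * c + 1))) :=
  D.consistent.filter fun T' => T'.2.1 = blockOfSeq Jh ∧ D.toMoreAsymHashed.CY T' Jh

/-- **Def. 6.16 is well posed**: `V_Y(Ĵ)` only depends on the level-`ℓ` complete split distributions of `Ĵ`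
("`p_compY` does not depend on the choice of `Y_Ĵ` and `Y_J` by symmetry, so it is well-defined").
[cite: AlmanDuanVassilevskaWilliamsXuXuZhou2025, Def. 6.16] -/
theorem card_compatTriplesY₂_eq_of_mem_shapeClass {Jh Jh' : Fin (n + n) → Fin c → Fin 3} (hJh' : Jh' ∈ D.shapeClass Jh) :
    (D.compatTriplesY₂ Jh').card = (D.compatTriplesY₂ Jh).card := by
  obtain ⟨σ, hσ, he⟩ := exists_chunkSymm_of_mem_pairTypeClass D.τ (mem_shapeClass_self Jh) hJh'
  have hσ' : σ.symm ∈ chunkSymmetries D.τ := (chunkSymmetries D.τ).inv_mem hσ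
  have he' : actSeq σ.symm Jh' = Jh := by rw [← he, actSeq_symm_actSeq]
  symm
  refine card_nbij' (permTriple σ) (permTriple σ.symm) (fun T hT => ?_) (fun T hT => ?_)
    (fun T _ => permTriple_symm_permTriple σ T) (fun T _ => permTriple_permTriple_symm σ T)
  · have h := mem_filter.1 (mem_coe.1 hT)
    refine mem_coe.2 (mem_filter.2 ⟨permTriple_mem_consistent hσ h.1, ?_, ?_⟩)
    · show actSeq σ T.2.1 = blockOfSeq Jh'
      rw [h.2.1, ← blockOfSeq_actSeq, he]
    · rw [← he, cy_permTriple_actSeq_iff hσ]; exact h.2.2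
  · have h := mem_filter.1 (mem_coe.1 hT)
    refine mem_coe.2 (mem_filter.2 ⟨permTriple_mem_consistent hσ' h.1, ?_, ?_⟩)
    · show actSeq σ.symm T.2.1 = blockOfSeq Jh
      rw [h.2.1, ← blockOfSeq_actSeq, he']
    · rw [← he', cy_permTriple_actSeq_iff hσ']; exact h.2.2

/-- **ADVXXZ Claim 6.18 as an exact double count**: `V_Y(Ĵ) · #{Ĵ' : ξ(Ĵ') = ξ(Ĵ)} ≤ numalpha · C_Y` — the
pairs (consistent triple, `Y`-compatible `Ĵ'` of the class of `Ĵ` in its `Y`-block) number `#class · V_Y(Ĵ)` by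
the symmetry, and are among ALL pairs (consistent triple, `Y`-compatible `Ĵ'` in its `Y`-block), which number
`numalpha · C_Y` (the level-`ℓ` condition dropped: an over-estimation, as in the proof of Claim 6.18).
[cite: AlmanDuanVassilevskaWilliamsXuXuZhou2025, Claim 6.18 (proof)] -/
theorem card_compatTriplesY₂_mul_card_shapeClass_le (hD : D.WellFormed)
    {T₀ : (Fin (n + n) → Fin (2 * c + 1)) × (Fin (n + n) → Fin (2 * c + 1)) × (Fin (n + n) → Fin (2 * c + 1))}
    (hT₀ : T₀ ∈ D.consistent) (Jh : Fin (n + n) → Fin c → Fin 3) :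
    (D.compatTriplesY₂ Jh).card * (D.shapeClass Jh).card ≤ D.consistent.card * D.compatCountY₂ T₀ := by
  set P₁ := (D.shapeClass Jh ×ˢ D.consistent).filter fun p => p.2.2.1 = blockOfSeq p.1 ∧ D.toMoreAsymHashed.CY p.2 p.1 with hP₁
  set P₂ := ((univ : Finset (Fin (n + n) → Fin c → Fin 3)) ×ˢ D.consistent).filter
    fun p => p.2.2.1 = blockOfSeq p.1 ∧ D.toMoreAsymHashed.CY p.2 p.1 with hP₂
  have h1 : P₁.card = (D.shapeClass Jh).card * (D.compatTriplesY₂ Jh).card := by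
    rw [card_eq_sum_card_fiberwise (f := Prod.fst) (s := P₁) (t := D.shapeClass Jh)
      (fun p hp => (mem_product.1 (mem_filter.1 hp).1).1)]
    rw [← Finset.sum_const_nat (m := (D.compatTriplesY₂ Jh).card) (f := fun Jh' => (P₁.filter fun p => p.1 = Jh').card)]
    intro Jh' hJh'
    rw [← card_compatTriplesY₂_eq_of_mem_shapeClass hJh']
    refine card_nbij' Prod.snd (fun T' => (Jh', T')) (fun p hp => ?_) (fun T' hT' => ?_) (fun p hp => ?_) (fun T' _ => rfl)
    · have hp' := mem_filter.1 (mem_coe.1 hp)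
      have hq := mem_filter.1 hp'.1
      refine mem_coe.2 (mem_filter.2 ⟨(mem_product.1 hq.1).2, ?_, ?_⟩)
      · rw [← hp'.2]; exact hq.2.1
      · rw [← hp'.2]; exact hq.2.2
    · have h := mem_filter.1 (mem_coe.1 hT')
      exact mem_coe.2 (mem_filter.2 ⟨mem_filter.2 ⟨mem_product.2 ⟨hJh', h.1⟩, h.2.1, h.2.2⟩, rfl⟩)
    · have hp' := mem_filter.1 (mem_coe.1 hp)
      exact Prod.ext hp'.2.symm rfl
  have h2 : P₂.card = D.consistent.card * D.compatCountY₂ T₀ := by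
    rw [card_eq_sum_card_fiberwise (f := Prod.snd) (s := P₂) (t := D.consistent)
      (fun p hp => (mem_product.1 (mem_filter.1 hp).1).2)]
    rw [← Finset.sum_const_nat (m := D.compatCountY₂ T₀) (f := fun T' => (P₂.filter fun p => p.2 = T').card)]
    intro T' hT'
    rw [← compatCountY₂_eq hD hT' hT₀, compatCountY₂]
    refine card_nbij' Prod.fst (fun Jh' => (Jh', T')) (fun p hp => ?_) (fun Jh' hJh' => ?_) (fun p hp => ?_) (fun Jh' _ => rfl)
    · have hp' := mem_filter.1 (mem_coe.1 hp)
      have hq := mem_filter.1 hp'.1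
      refine mem_coe.2 (mem_filter.2 ⟨mem_univ _, ?_, ?_⟩)
      · rw [← hp'.2]; exact hq.2.1.symm
      · rw [← hp'.2]; exact hq.2.2
    · have h := mem_filter.1 (mem_coe.1 hJh')
      exact mem_coe.2 (mem_filter.2 ⟨mem_filter.2 ⟨mem_product.2 ⟨mem_univ _, hT'⟩, h.2.1.symm, h.2.2⟩, rfl⟩)
    · have hp' := mem_filter.1 (mem_coe.1 hp)
      exact Prod.ext rfl hp'.2.symm
  have hsub : P₁ ⊆ P₂ := by
    intro p hp
    have hp' := mem_filter.1 hp
    exact mem_filter.2 ⟨mem_product.2 ⟨mem_univ _, (mem_product.1 hp'.1).2⟩, hp'.2⟩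
  calc (D.compatTriplesY₂ Jh).card * (D.shapeClass Jh).card = P₁.card := by rw [h1, mul_comm]
    _ ≤ P₂.card := card_le_card hsub
    _ = D.consistent.card * D.compatCountY₂ T₀ := h2

/-- **`U_Y(T) ≤ ∑_{Ĵ ∈ A useful} V_Y(Ĵ)`** (Claim 6.21's proof: each hole pair `(Ĵ, T')` has `T'` among the
consistent triples through `Y_J` `Y`-compatible with `Ĵ`). [cite: AlmanDuanVassilevskaWilliamsXuXuZhou2025, Claim 6.21 (second part)] -/
theorem card_holePairsYIn_le (A : Finset (Fin (n + n) → Fin c → Fin 3))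
    (T : (Fin (n + n) → Fin (2 * c + 1)) × (Fin (n + n) → Fin (2 * c + 1)) × (Fin (n + n) → Fin (2 * c + 1))) :
    (D.toMoreAsymHashed.holePairsYIn A T).card ≤
      ∑ Jh ∈ A.filter (fun Jh => blockOfSeq Jh = T.2.1 ∧ D.toMoreAsymHashed.UY T Jh), (D.compatTriplesY₂ Jh).card := by
  rw [MoreAsymHashedZeroOut.holePairsYIn,
    card_eq_sum_card_fiberwise (f := Prod.fst) (t := A.filter fun Jh => blockOfSeq Jh = T.2.1 ∧ D.toMoreAsymHashed.UY T Jh)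
      (fun q hq => by
        obtain ⟨hq𝒯, hb, hu, -⟩ := mem_filter.1 hq
        exact mem_filter.2 ⟨(mem_product.1 hq𝒯).1, hb, hu⟩)]
  refine sum_le_sum fun Jh hJh => ?_
  refine card_le_card_of_injOn (fun q => q.2) (fun q hq => ?_) (fun q₁ h₁ q₂ h₂ heq => ?_)
  · rw [mem_coe, mem_filter] at hq
    obtain ⟨hq, hq1⟩ := hq
    obtain ⟨hq𝒯, hb, -, -, hJ, hc⟩ := mem_filter.1 hq
    rw [mem_coe, compatTriplesY₂, mem_filter]
    refine ⟨(mem_product.1 hq𝒯).2, ?_, ?_⟩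
    · rw [hJ, ← hb, hq1]
    · rw [← hq1]; exact hc
  · rw [mem_coe, mem_filter] at h₁ h₂
    exact Prod.ext (h₁.2.trans h₂.2.symm) heq

variable (D) in
/-- **`M_Y(T)`**: the number of level-1 `Y`-sequences in `Y_J` useful for `T` (the level-1 `Y`-blocks of `𝒯*_T`).
[cite: AlmanDuanVassilevskaWilliamsXuXuZhou2025, §6.5 (𝒯*) and Thm. 4.2 (M_Y)] -/
def usefulYCount₂ (T : (Fin (n + n) → Fin (2 * c + 1)) × (Fin (n + n) → Fin (2 * c + 1)) × (Fin (n + n) → Fin (2 * c + 1))) : ℕ :=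
  (univ.filter fun Jh : Fin (n + n) → Fin c → Fin 3 => blockOfSeq Jh = T.2.1 ∧ D.toMoreAsymHashed.UY T Jh).card

/-- **`U_Y(T) · m ≤ M_Y(T) · numalpha · C_Y`** whenever every relevant useful `Ĵ` has a class of size `≥ m`
(Claims 6.18 and 6.21 combined). [cite: AlmanDuanVassilevskaWilliamsXuXuZhou2025, Claims 6.18 and 6.21] -/
theorem card_holePairsYIn_mul_le (hD : D.WellFormed) (A : Finset (Fin (n + n) → Fin c → Fin 3))
    {T T₀ : (Fin (n + n) → Fin (2 * c + 1)) × (Fin (n + n) → Fin (2 * c + 1)) × (Fin (n + n) → Fin (2 * c + 1))}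
    (hT₀ : T₀ ∈ D.consistent) {m : ℕ}
    (hm : ∀ Jh ∈ A, blockOfSeq Jh = T.2.1 → D.toMoreAsymHashed.UY T Jh → m ≤ (D.shapeClass Jh).card) :
    (D.toMoreAsymHashed.holePairsYIn A T).card * m ≤ D.usefulYCount₂ T * (D.consistent.card * D.compatCountY₂ T₀) := by
  set U := A.filter fun Jh => blockOfSeq Jh = T.2.1 ∧ D.toMoreAsymHashed.UY T Jh with hU
  have hUle : U.card ≤ D.usefulYCount₂ T := by
    refine card_le_card fun Jh hJh => ?_
    have h := mem_filter.1 hJh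
    exact mem_filter.2 ⟨mem_univ _, h.2⟩
  calc (D.toMoreAsymHashed.holePairsYIn A T).card * m ≤ (∑ Jh ∈ U, (D.compatTriplesY₂ Jh).card) * m :=
        Nat.mul_le_mul_right _ (card_holePairsYIn_le A T)
    _ = ∑ Jh ∈ U, (D.compatTriplesY₂ Jh).card * m := by rw [sum_mul]
    _ ≤ ∑ Jh ∈ U, (D.compatTriplesY₂ Jh).card * (D.shapeClass Jh).card := by
        refine sum_le_sum fun Jh hJh => Nat.mul_le_mul_left _ ?_
        have h := mem_filter.1 hJh
        exact hm Jh h.1 h.2.1 h.2.2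
    _ ≤ ∑ _Jh ∈ U, D.consistent.card * D.compatCountY₂ T₀ :=
        sum_le_sum fun Jh _ => card_compatTriplesY₂_mul_card_shapeClass_le hD hT₀ Jh
    _ = U.card * (D.consistent.card * D.compatCountY₂ T₀) := by rw [sum_const, smul_eq_mul]
    _ ≤ D.usefulYCount₂ T * (D.consistent.card * D.compatCountY₂ T₀) := Nat.mul_le_mul_right _ hUle

end ConstituentRegion

end Literature.Computability.AlgebraicComplexity
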